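import Summits.Ventures.HSemireg.WedgeHankelRecurrenceGaussChebyshevResultant

/-!
# Venture HSemireg — **THE DISCRIMINANTS OF THE CHEBYSHEV POLYNOMIALS**: **`disc(T_{n+1}) = (n+1)^{n+1} 2^{n²}`** and **`(n+2)² disc(U_{n+1}) = (n+2)^{n+1} 2^{(n+1)²}`**
# (Mathlib's `Polynomial.Chebyshev.T ∕ U`, `Polynomial.discr`, over `ℤ` and over `ℝ`), by SCHUR's method (N404) from the lowering relations `(1 − X²) T_{n+1}′ = (n+1)(T_n − X T_{n+1})`,
# `(1 − X²) U_{n+1}′ = (n+2) U_n − (n+1) X U_{n+1}` and the resultants of N406; **`disc(c·f) = c^{2m} disc f`** (`deg f = m + 1`); and STIELTJES' value of the CHEBYSHEV-NODE VANDERMONDE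
# **`∏_{i<j} (x_j − x_i)² = (n+1)^{n+1} ∕ 2^{n²}`** at `x_k = cos((2k+1)π∕(2n+2))`

HONEST FRAMING. Part of the Lean index of the computation cell `pub-hsemireg` (seat p10 gen 47, Sunday typer «UNIFORM-IN-n»).  Polynomial algebra (Mathlib `Polynomial.resultant ∕ discr ∕ Chebyshev`)
and one real cosine product identity only; no variety, no cohomology theory, no sheaf, no Ext group and no semiregularity map is constructed here; nothing here says that HC / HC_CM / HC_AV holds;
no Literature fact (unproved `Prop`) is declared or used.  Custodian versions as in `WedgeHankelSiegelIdeal` (1/3).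
SOURCES (cited).  T. J. Stieltjes, C. R. Acad. Sci. Paris 100 (1885) 620–622; D. Hilbert, J. reine angew. Math. 103 (1888) 337–345; I. Schur, J. reine angew. Math. 165 (1931) 52–58, §2;
G. Szegő, *Orthogonal Polynomials*, Thm 6.71 (Jacobi case `α = β = −½`, `+½`); K. Dilcher, K. B. Stolarsky, Trans. Amer. Math. Soc. 357 (2005) 965–981, eq. (1.3)–(1.4)
(`disc T_n = 2^{(n−1)²} n^n`, `disc U_n = 2^{n²} (n+1)^{n−2}`); T. J. Rivlin, *Chebyshev Polynomials* (1990), Ex. 1.5.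
PROOF TYPED HERE.  `Res_{(m,2)}(f, 1 − X²) = (−1)^m f(1) f(−1)` (factor `−(X − 1)(X + 1)`, Mathlib `resultant_mul_right`, `resultant_X_sub_C_right ∕ X_add_C_right`), `= 1` for `T_{n+1}` and `(n+2)²`
for `U_{n+1}` (Mathlib `T_eval_one ∕ T_eval_neg_one ∕ U_eval_one ∕ U_eval_neg_one`); N404 `resultant_mul_discr_eq` with `π = 1 − X²`, `A = −(n+1)X`, `c = n+1 ∕ n+2`; N406 resultants; cancellation in `ℤ`.
DEDUP DISCLOSURE (`rg -n -i 'chebyshev.*discr|discr.*chebyshev|discr_C_mul|T_discr|U_discr' Summits/Ventures/HSemireg Literature .lake/packages/mathlib/Mathlib`, 2026-09-04): nothing on Chebyshev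
discriminants in Mathlib ∕ Literature ∕ the lineage; N359-block `chebyshev_recurrence_eq_prod ∕ _eq_T` (nodes factorisation, reused); 0 hits for the 9 names below.

WHAT IS IN THE TREE.  N404 `resultant_mul_discr_eq`; N405 `discr_map_of_injective`; N406 `chebyshevT_natDegree_coeff`, `chebyshevU_natDegree_coeff`, `chebyshevT_resultant`, `chebyshevU_resultant`,
`one_sub_X_sq_mul_derivative_U`; N3xx `chebyshev_recurrence_eq_prod`, `chebyshev_recurrence_eq_T`, `recurrence_of_coefficients`; N653-block `discr_prod_X_sub_C`; Mathlib
`one_sub_X_sq_mul_derivative_T_eq_poly_in_T`, `T_eval_one`, `T_eval_neg_one`, `U_eval_one`, `U_eval_neg_one`, `Int.coe_negOnePow_natCast`, `map_T`, `map_U`.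
THIS FILE (namespace `Summit.Ventures.HSemireg.Wedge.HankelOuter` continued; CHAINED on N406; 0 definitions):
* §1172 `resultant_one_sub_X_sq` (`Res_{(m,2)}(f, 1 − X²) = (−1)^m f(1) f(−1)`, nontrivial commutative ring), `chebyshevT_resultant_one_sub_X_sq` (`= 1`), `chebyshevU_resultant_one_sub_X_sq` (`= (n+2)²`),
  **`chebyshevT_discr`** (`disc T_{n+1} = (n+1)^{n+1} 2^{n²}` in `ℤ`), **`chebyshevU_discr`** (`(n+2)² disc U_{n+1} = (n+2)^{n+1} 2^{(n+1)²}`), `chebyshevU_discr'` (`disc U_{n+2} = (n+3)^n 2^{(n+2)²}`),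
  `chebyshevT_discr_real`, `chebyshevU_discr_real`, **`discr_C_mul`** (`disc(c f) = c^{2m} disc f`, `deg f = m+1`, domain), **`chebyshev_nodes_discr`** (`(∏_{i<j}(x_j − x_i))² = (n+1)^{n+1} (1∕2)^{n²}`
  at the Chebyshev nodes).
CAVEATS.  `disc U_{n+1}` is stated with the factor `(n+2)²` on the left (for `n = 0` the «closed form» `(n+2)^{n−1}` would need a negative exponent); the cancelled form is given from degree `2` on.
Nothing Ext-side.  New names only.
-/

open Module Polynomial Real
open scoped Matrix Polynomial

namespace Summit.Ventures.HSemireg.Wedge.HankelOuter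

/-! ## §1172. Chebyshev discriminants -/

/-- `Res_{(m,2)}(f, 1 − X²) = (−1)^m · f(1) · f(−1)` (`deg f ≤ m`, nontrivial commutative ring; `1 − X² = −(X − 1)(X + 1)`). [this file, §1172] -/
theorem resultant_one_sub_X_sq {R : Type*} [CommRing R] [Nontrivial R] {f : R[X]} {m : ℕ} (hf : f.natDegree ≤ m) :
    f.resultant (1 - Polynomial.X ^ 2) m 2 = (-1) ^ m * (f.eval 1 * f.eval (-1)) := by
  have hm := resultant_mul_right f (Polynomial.X - C 1) (Polynomial.X + C 1) m hf
  rw [natDegree_X_sub_C, natDegree_X_add_C, show (1 : ℕ) + 1 = 2 from rfl, resultant_X_sub_C_right _ _ _ hf, resultant_X_add_C_right _ _ _ hf] at hm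
  rw [show (1 - Polynomial.X ^ 2 : R[X]) = C (-1 : R) * ((Polynomial.X - C 1) * (Polynomial.X + C 1)) by simp only [map_neg, map_one]; ring, resultant_C_mul_right, hm]
  have hsq : ((-1 : R) ^ m) * ((-1 : R) ^ m) = 1 := by rw [← pow_add, ← two_mul, pow_mul, neg_one_sq, one_pow]
  linear_combination ((-1 : R) ^ m * f.eval 1 * f.eval (-1)) * hsq

/-- `Res_{(n+1,2)}(T_{n+1}, 1 − X²) = 1` over `ℤ` (`T(1) = 1`, `T(−1) = (−1)^{n+1}`). [this file, §1172] -/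
theorem chebyshevT_resultant_one_sub_X_sq (n : ℕ) : (Polynomial.Chebyshev.T ℤ ((n : ℤ) + 1)).resultant (1 - Polynomial.X ^ 2) (n + 1) 2 = 1 := by
  obtain ⟨hd, -⟩ := chebyshevT_natDegree_coeff n
  have hneg : ((((n : ℤ) + 1).negOnePow : ℤˣ) : ℤ) = (-1) ^ (n + 1) := by
    rw [show ((n : ℤ) + 1) = ((n + 1 : ℕ) : ℤ) by push_cast; ring]; exact Int.coe_negOnePow_natCast (n + 1)
  rw [resultant_one_sub_X_sq hd.le, Polynomial.Chebyshev.T_eval_one, Polynomial.Chebyshev.T_eval_neg_one, hneg, Int.cast_id, one_mul, ← pow_add, ← two_mul, pow_mul, neg_one_sq, one_pow]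

/-- `Res_{(n+1,2)}(U_{n+1}, 1 − X²) = (n+2)²` over `ℤ` (`U_{n+1}(1) = n+2`, `U_{n+1}(−1) = (−1)^{n+1}(n+2)`). [this file, §1172] -/
theorem chebyshevU_resultant_one_sub_X_sq (n : ℕ) : (Polynomial.Chebyshev.U ℤ ((n : ℤ) + 1)).resultant (1 - Polynomial.X ^ 2) (n + 1) 2 = ((n : ℤ) + 2) ^ 2 := by
  obtain ⟨hd, -⟩ := chebyshevU_natDegree_coeff (n + 1)
  push_cast at hd
  have hneg : ((((n : ℤ) + 1).negOnePow : ℤˣ) : ℤ) = (-1) ^ (n + 1) := by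
    rw [show ((n : ℤ) + 1) = ((n + 1 : ℕ) : ℤ) by push_cast; ring]; exact Int.coe_negOnePow_natCast (n + 1)
  rw [resultant_one_sub_X_sq hd.le, Polynomial.Chebyshev.U_eval_one, Polynomial.Chebyshev.U_eval_neg_one, hneg]
  simp only [Int.cast_id]
  have hsq : ((-1 : ℤ) ^ (n + 1)) * ((-1 : ℤ) ^ (n + 1)) = 1 := by rw [← pow_add, ← two_mul, pow_mul, neg_one_sq, one_pow]
  linear_combination (((n : ℤ) + 1 + 1) ^ 2) * hsq

/-- **`disc(T_{n+1}) = (n+1)^{n+1} · 2^{n²}`** for Mathlib's Chebyshev polynomial of the first kind over `ℤ`. [Stieltjes 1885; Hilbert 1888; Szegő Thm 6.71; Dilcher–Stolarsky (1.3); this file, §1172] -/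
theorem chebyshevT_discr (n : ℕ) : (Polynomial.Chebyshev.T ℤ ((n : ℤ) + 1)).discr = ((n : ℤ) + 1) ^ (n + 1) * 2 ^ (n ^ 2) := by
  obtain ⟨hd, hc⟩ := chebyshevT_natDegree_coeff n
  have hdn : (Polynomial.Chebyshev.T ℤ (n : ℤ)).natDegree ≤ n := by rw [Polynomial.Chebyshev.natDegree_T]; omega
  have hlc : (Polynomial.Chebyshev.T ℤ ((n : ℤ) + 1)).leadingCoeff = 2 ^ n := by rw [leadingCoeff, hd, hc]
  have hlow : (1 - Polynomial.X ^ 2) * derivative (Polynomial.Chebyshev.T ℤ ((n : ℤ) + 1)) =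
      (C (-((n : ℤ) + 1)) * Polynomial.X) * Polynomial.Chebyshev.T ℤ ((n : ℤ) + 1) + C ((n : ℤ) + 1) * Polynomial.Chebyshev.T ℤ (n : ℤ) := by
    rw [Polynomial.Chebyshev.one_sub_X_sq_mul_derivative_T_eq_poly_in_T (R := ℤ) (n : ℤ)]
    simp only [map_add, map_neg, map_natCast, map_one]
    push_cast
    ring
  have hπ : (1 - Polynomial.X ^ 2 : ℤ[X]).natDegree ≤ 2 :=
    (natDegree_sub_le _ _).trans (max_le (by rw [natDegree_one]; omega) (natDegree_pow_le_of_le 2 natDegree_X_le))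
  have hA : (C (-((n : ℤ) + 1)) * Polynomial.X).natDegree + 1 ≤ 2 := by have := (natDegree_C_mul_le (-((n : ℤ) + 1)) Polynomial.X).trans natDegree_X_le; omega
  have e := resultant_mul_discr_eq hd hπ hA hdn hlow
  rw [hlc, chebyshevT_resultant_one_sub_X_sq, chebyshevT_resultant, one_mul, show (n + 1) * n / 2 = n * (n + 1) / 2 by rw [mul_comm]] at e
  have hne : (-1 : ℤ) ^ (n * (n + 1) / 2) * 2 ^ n ≠ 0 := mul_ne_zero (pow_ne_zero _ (by norm_num)) (pow_ne_zero _ (by norm_num))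
  apply mul_left_cancel₀ hne
  have h3 : n ^ 2 = n * (n - 1) + n := by
    rcases n with _ | k
    · rfl
    · rw [Nat.add_sub_cancel]; ring
  rw [h3]
  linear_combination e

/-- **`(n+2)² · disc(U_{n+1}) = (n+2)^{n+1} · 2^{(n+1)²}`** for Mathlib's Chebyshev polynomial of the second kind over `ℤ`. [Stieltjes 1885; Szegő Thm 6.71; Dilcher–Stolarsky (1.4); this file,
§1172] -/
theorem chebyshevU_discr (n : ℕ) : ((n : ℤ) + 2) ^ 2 * (Polynomial.Chebyshev.U ℤ ((n : ℤ) + 1)).discr = ((n : ℤ) + 2) ^ (n + 1) * 2 ^ ((n + 1) ^ 2) := by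
  obtain ⟨hd, hc⟩ := chebyshevU_natDegree_coeff (n + 1)
  obtain ⟨hdn, -⟩ := chebyshevU_natDegree_coeff n
  push_cast at hd hc
  have hlc : (Polynomial.Chebyshev.U ℤ ((n : ℤ) + 1)).leadingCoeff = 2 ^ (n + 1) := by rw [leadingCoeff, hd, hc]
  have hlow : (1 - Polynomial.X ^ 2) * derivative (Polynomial.Chebyshev.U ℤ ((n : ℤ) + 1)) =
      (C (-((n : ℤ) + 1)) * Polynomial.X) * Polynomial.Chebyshev.U ℤ ((n : ℤ) + 1) + C ((n : ℤ) + 2) * Polynomial.Chebyshev.U ℤ (n : ℤ) := by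
    rw [one_sub_X_sq_mul_derivative_U ℤ (n : ℤ)]
    simp only [map_add, map_neg, map_natCast, map_one, map_ofNat]
    push_cast
    ring
  have hπ : (1 - Polynomial.X ^ 2 : ℤ[X]).natDegree ≤ 2 :=
    (natDegree_sub_le _ _).trans (max_le (by rw [natDegree_one]; omega) (natDegree_pow_le_of_le 2 natDegree_X_le))
  have hA : (C (-((n : ℤ) + 1)) * Polynomial.X).natDegree + 1 ≤ 2 := by have := (natDegree_C_mul_le (-((n : ℤ) + 1)) Polynomial.X).trans natDegree_X_le; omega
  have e := resultant_mul_discr_eq hd hπ hA hdn.le hlow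
  rw [hlc, chebyshevU_resultant_one_sub_X_sq, chebyshevU_resultant, show (n + 1) * n / 2 = n * (n + 1) / 2 by rw [mul_comm]] at e
  have hne : (-1 : ℤ) ^ (n * (n + 1) / 2) * 2 ^ (n + 1) ≠ 0 := mul_ne_zero (pow_ne_zero _ (by norm_num)) (pow_ne_zero _ (by norm_num))
  apply mul_left_cancel₀ hne
  rw [show (n + 1) ^ 2 = n * (n + 1) + (n + 1) by ring]
  linear_combination e

/-- From degree `2` on the factor cancels: **`disc(U_{n+2}) = (n+3)^n · 2^{(n+2)²}`**. [Dilcher–Stolarsky (1.4); this file, §1172] -/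
theorem chebyshevU_discr' (n : ℕ) : (Polynomial.Chebyshev.U ℤ ((n : ℤ) + 2)).discr = ((n : ℤ) + 3) ^ n * 2 ^ ((n + 2) ^ 2) := by
  have h := chebyshevU_discr (n + 1)
  push_cast at h
  rw [show (n : ℤ) + 1 + 1 = (n : ℤ) + 2 by ring, show (n : ℤ) + 1 + 2 = (n : ℤ) + 3 by ring] at h
  have hne : ((n : ℤ) + 3) ^ 2 ≠ 0 := pow_ne_zero _ (by positivity)
  apply mul_left_cancel₀ hne
  rw [h]
  ring

/-- `disc(T_{n+1}) = (n+1)^{n+1} 2^{n²}` read over `ℝ`. [this file, §1172] -/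
theorem chebyshevT_discr_real (n : ℕ) : (Polynomial.Chebyshev.T ℝ ((n : ℤ) + 1)).discr = ((n : ℝ) + 1) ^ (n + 1) * 2 ^ (n ^ 2) := by
  rw [← Polynomial.Chebyshev.map_T (Int.castRingHom ℝ), discr_map_of_injective (Int.castRingHom ℝ).injective_int, chebyshevT_discr]
  simp

/-- `(n+2)² disc(U_{n+1}) = (n+2)^{n+1} 2^{(n+1)²}` read over `ℝ`. [this file, §1172] -/
theorem chebyshevU_discr_real (n : ℕ) : ((n : ℝ) + 2) ^ 2 * (Polynomial.Chebyshev.U ℝ ((n : ℤ) + 1)).discr = ((n : ℝ) + 2) ^ (n + 1) * 2 ^ ((n + 1) ^ 2) := by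
  rw [← Polynomial.Chebyshev.map_U (Int.castRingHom ℝ), discr_map_of_injective (Int.castRingHom ℝ).injective_int]
  have h := congrArg (Int.castRingHom ℝ) (chebyshevU_discr n)
  simp only [map_mul, map_pow, map_add, map_natCast, map_ofNat] at h
  exact h

/-- **`disc(c · f) = c^{2m} · disc f`** for `deg f = m + 1` and `c ≠ 0` in a domain. [Szegő (6.71.1) (homogeneity of the discriminant); this file, §1172] -/
theorem discr_C_mul {K : Type*} [CommRing K] [IsDomain K] {f : K[X]} {m : ℕ} (hfd : f.natDegree = m + 1) {c : K} (hc : c ≠ 0) :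
    (C c * f).discr = c ^ (2 * m) * f.discr := by
  have hd' : (C c * f).natDegree = m + 1 := by rw [natDegree_C_mul hc, hfd]
  have hlc' : (C c * f).leadingCoeff = c * f.leadingCoeff := by rw [leadingCoeff_mul, leadingCoeff_C]
  have hlc0 : f.leadingCoeff ≠ 0 := fun h => by rw [leadingCoeff_eq_zero] at h; rw [h, natDegree_zero] at hfd; omega
  have h1 := resultant_deriv (f := f) (natDegree_pos_iff_degree_pos.mp (by omega))
  have h2 := resultant_deriv (f := C c * f) (natDegree_pos_iff_degree_pos.mp (by omega))
  rw [hd', hlc', Nat.add_sub_cancel, derivative_C_mul, resultant_C_mul_left, resultant_C_mul_right] at h2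
  rw [hfd, Nat.add_sub_cancel] at h1
  rw [h1] at h2
  have hne : (-1 : K) ^ ((m + 1) * m / 2) * (c * f.leadingCoeff) ≠ 0 := mul_ne_zero (pow_ne_zero _ (neg_ne_zero.mpr one_ne_zero)) (mul_ne_zero hc hlc0)
  apply mul_left_cancel₀ hne
  linear_combination (-1 : K) * h2

/-- **THE CHEBYSHEV-NODE VANDERMONDE: `(∏_{i<j} (x_j − x_i))² = (n+1)^{n+1} · (1∕2)^{n²}`** at the increasing Chebyshev nodes `x_k = cos((2(n−k)+1)π∕(2n+2))`, `k = 0, …, n` (the zeros of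
`T_{n+1}`; monic normalisation `2^{−n} T_{n+1}`). [Stieltjes 1885; Szegő Thm 6.71 ∕ §6.7; this file, §1172] -/
theorem chebyshev_nodes_discr (n : ℕ) :
    (∏ i : Fin (n + 1), ∏ j ∈ Finset.Ioi i, (cos ((2 * ((Fin.rev j : Fin (n + 1)) : ℝ) + 1) * π / (2 * ((n : ℝ) + 1))) - cos ((2 * ((Fin.rev i : Fin (n + 1)) : ℝ) + 1) * π / (2 * ((n : ℝ) + 1))))) ^ 2 =
      ((n : ℝ) + 1) ^ (n + 1) * (1 / 2 : ℝ) ^ (n ^ 2) := by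
  obtain ⟨q, hq0, hq1, hrec⟩ := recurrence_of_coefficients (fun _ => (0 : ℝ)) (fun j => if j = 1 then (1 / 2 : ℝ) else 1 / 4)
  have hprod := chebyshev_recurrence_eq_prod (a := fun _ => (0 : ℝ)) (b := fun j => if j = 1 then (1 / 2 : ℝ) else 1 / 4) hq0 hq1 hrec (fun _ => rfl) (if_pos rfl) (fun m => if_neg (by omega)) n
  have hT := chebyshev_recurrence_eq_T (a := fun _ => (0 : ℝ)) (b := fun j => if j = 1 then (1 / 2 : ℝ) else 1 / 4) hq0 hq1 hrec (fun _ => rfl) (if_pos rfl) (fun m => if_neg (by omega)) n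
  have hdT : (Polynomial.Chebyshev.T ℝ ((n : ℤ) + 1)).natDegree = n + 1 := by rw [Polynomial.Chebyshev.natDegree_T]; omega
  rw [← discr_prod_X_sub_C ℝ, ← hprod, hT, discr_C_mul hdT (pow_ne_zero _ (by norm_num)), chebyshevT_discr_real, ← pow_mul]
  have h22 : (1 / 2 : ℝ) ^ (2 * n * n) * 2 ^ (n ^ 2) = (1 / 2 : ℝ) ^ (n ^ 2) := by
    rw [show 2 * n * n = n ^ 2 + n ^ 2 by ring, pow_add, mul_assoc, ← mul_pow]; norm_num
  linear_combination (((n : ℝ) + 1) ^ (n + 1)) * h22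

end Summit.Ventures.HSemireg.Wedge.HankelOuter
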